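import Literature.MathematicalPhysics.QuantumFieldTheory.Balaban1983to89.B11Eq26ActionExpansion
import Literature.MathematicalPhysics.QuantumFieldTheory.Balaban1983to89.B9Eq310Hermitian
import HarnessLib

/-!
# K0⁷ STUB 1 (`stub_prop8StepCoP13`), S4b ♭ road — **REALITY OF [15] (26)'s `V₀` ON THE GROUP**: for a unitary background `U₀`, a Hermitian fluctuation field `A` and a tracial
# `*`-compatible `τ`, `V₀(A) = 𝒜(U₁U₀) − 𝒜(U₀) − ⟨A, J⟩ − ½⟨A, ΔA⟩` is REAL (`conj V₀ = V₀`), generic complete normed `*`-algebra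

Cell `pub-ymgap`, width seat `pub-ymgap-k0-s1-w4` g2 (CLAIM-7, bus 2026-08-28T12:5xZ).  `--kind proof --supports stmt-QuantumFields-20541 --as helper`; count-neutral.
[15] = [Balaban1985Variational]; [5] = [Balaban1985BackgroundPropagators].

WHY.  The Sect. F W-slot Socket (k0-s1-w2 p621022, C″ p633312) certifies `HasFDerivAt V (BE (W A′)) A′` for print's (80)
`V(A) = ½B(Dsel A, M(Dsel A)) − B(Q A, M(Dsel A)) + V₀[shifts, 1](A − H·Dsel A)`; k0-s1-w2's `K0Stub1RealityFromCertificate.herm_of_certificate` turns that into «`W A′` is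
Hermitian-valued» (`hWA`) GIVEN `hreal`: `V(A′ + tδ)` real for real `t` along Hermitian `δ`.  The `B`-summands are real on Hermitian data by `hτ`∕`hτs` and the reality of `Dsel♭`, `Q_lin♭`,
`M♭` (CLAIM-5∕6b, real kernels); this file supplies the remaining feed — the `V₀`-summand: on the group (`U₀(b)⁻¹ = U₀(b)*`) and for Hermitian `A`, `U₁ = e^{iηA}` is unitary, the
Wilson functional `𝒜 = Σ_p η^{d−4}(τ1 − τ Re U(∂p))` is real on unitary configurations, `⟨A, J⟩` and `⟨A, ΔA⟩` are real ([5] (3.10)–(3.11); `B9Eq310Hermitian`), hence `V₀(A) ∈ ℝ`.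

WHAT IS PROVED (sorry-free; no definition; axioms standard; generic complete normed ℂ-algebra `𝔸` with continuous `*`, `StarModule ℂ`).
* §1 `star_J` (the current (28) is Hermitian on the group), `fluct_inv_eq_star` (`e^{iηA(b)}` is unitary for Hermitian `A(b)`: `(e^{X})⁻¹ = e^{−X} = e^{X*} = (e^{X})*`),
  `prodCfg_inv_eq_star` (`U₁U₀` is unitary).
* §2 `conj_wil` (`τ1 − τ Re W` is real for unitary `W`), ★ `conj_action` (the Wilson functional is real on unitary configurations), ★★ `conj_V0`, ★★ `V0_im_eq_zero`, `V0_eq_ofReal_re`,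
  ★ `re_V0_eq_sum_re_rem3` (`Re V₀ = η^{d−4}Σ_p Re ρ_p`, the `V₀` dictionary towards S1's `Σ Re rem3` form; `B11Eq26ActionExpansion.V0_eq_sum_rem3`).
HONEST SCOPE.  Folklore `*`-bookkeeping over the Literature's (26)∕(3.10)∕(3.11) letters; nothing of [15]'s estimates asserted; the `hreal` junction itself (k0-s1-w2's (t4‴)) is NOT
here; `stub_prop8StepCoP13` ∕ K0⁷ NOT closed; N07 NOT discharged; no summit statement is proved by this seat; counts unmoved (28∕28 · 5∕27); one finite 𝕋⁴ programme at fixed ε —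
R4 closes the conditional finite-𝕋⁴ rung only; the YM mass gap (Clay) is NOT proved by any of this.  No `sorry`, no `def`, no `instance`, no `notation`.

References: [15] (5) p.278, (26)–(28) p.282, (80) p.289; [5] (3.1) p.390, (3.10)–(3.11) p.392.
-/

set_option autoImplicit false

noncomputable section

open scoped BigOperators
open NormedSpace

namespace Summit.QuantumFields.YangMills.Theorems.K0Stub1V0Reality

open Literature.MathematicalPhysics.QuantumFieldTheory.Balaban1983to89
open B9Eq37Insertion (wil reC imC holU val_holU val_inv_holU star_reC star_imC)
open B9Eq39Adjoint (plaqU divP divPη J fluct prodCfg action bondPair hessPair)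
open B9Eq310Hermitian (unitary_mul unitary_inv plaqU_unitary star_divP star_eta_sq conj_bondPair conj_hessPair)
open B11Eq26ActionExpansion (V0)
open Beta.AdjointTransportJets (invPath_cons invPath_nil)
open Beta.TransportVertices (holonomy holonomy_cons holonomy_nil)

variable {𝔸 : Type*} [NormedRing 𝔸] [NormedAlgebra ℂ 𝔸] [CompleteSpace 𝔸] [StarRing 𝔸] [ContinuousStar 𝔸] [StarModule ℂ 𝔸]
variable {S : Type*} [Fintype S] {ι : Type*} [Fintype ι] [LinearOrder ι]
variable (T : ι → Equiv.Perm S) (U : ι → S → 𝔸ˣ)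

/-! ## §1 The current is Hermitian and the product configuration is unitary -/

omit [CompleteSpace 𝔸] [ContinuousStar 𝔸] [Fintype S] in
/-- **THE CURRENT (28) IS HERMITIAN ON THE GROUP**: `J(b)* = J(b)` for a unitary background (`J = η⁻¹D*(η⁻²·Im U(∂p))`; `(Im W)* = Im W` for unitary `W`, `(D*F)* = D*(F*)`).
[cite: Balaban1985Variational, (28) p.282; Balaban1985BackgroundPropagators, (3.11) p.392] -/
theorem star_J (hU : ∀ μ x, (((U μ x)⁻¹ : 𝔸ˣ) : 𝔸) = star (U μ x : 𝔸)) (η : ℝ) (μ : ι) (x : S) :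
    star (J T U η μ x) = J T U η μ x := by
  unfold J divPη
  rw [star_smul, star_divP T U hU, Complex.star_def, map_inv₀, Complex.conj_ofReal]
  congr 1
  congr 1
  funext μ' ν' y
  show star ((((η : ℂ)⁻¹) ^ 2) • imC (plaqU T U μ' ν' y)) = (((η : ℂ)⁻¹) ^ 2) • imC (plaqU T U μ' ν' y)
  rw [star_smul, star_eta_sq, star_imC (plaqU_unitary T U hU μ' ν' y)]

omit [Fintype S] [Fintype ι] [LinearOrder ι] in
/-- **`e^{iηA(b)}` IS UNITARY FOR HERMITIAN `A(b)`**: `(e^{iηA})⁻¹ = e^{−iηA} = e^{(iηA)*} = (e^{iηA})*`. [cite: Balaban1985Variational, (26) p.282] -/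
theorem fluct_inv_eq_star (η : ℝ) {A : ι → S → 𝔸} (hA : ∀ μ x, star (A μ x) = A μ x) (μ : ι) (x : S) :
    (((fluct η A μ x)⁻¹ : 𝔸ˣ) : 𝔸) = star (fluct η A μ x : 𝔸) := by
  unfold fluct
  rw [val_inv_holU, val_holU, invPath_cons, invPath_nil, List.nil_append, holonomy_cons, holonomy_cons, holonomy_nil, mul_one, mul_one,
    star_exp, star_smul, hA, Complex.star_def, map_mul, Complex.conj_I, Complex.conj_ofReal, neg_mul, neg_smul]

omit [Fintype S] [Fintype ι] [LinearOrder ι] in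
/-- **`U₁U₀` IS UNITARY** for a unitary background and Hermitian `A`. [cite: Balaban1985Variational, (26) p.282] -/
theorem prodCfg_inv_eq_star (hU : ∀ μ x, (((U μ x)⁻¹ : 𝔸ˣ) : 𝔸) = star (U μ x : 𝔸)) (η : ℝ) {A : ι → S → 𝔸} (hA : ∀ μ x, star (A μ x) = A μ x) :
    ∀ μ x, (((prodCfg U η A μ x)⁻¹ : 𝔸ˣ) : 𝔸) = star (prodCfg U η A μ x : 𝔸) :=
  fun μ x => unitary_mul (fluct_inv_eq_star η hA μ x) (hU μ x)

/-! ## §2 Reality of the Wilson functional and of `V₀` -/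

omit [CompleteSpace 𝔸] [ContinuousStar 𝔸] [Fintype S] [Fintype ι] [LinearOrder ι] in
/-- **`τ1 − τ Re W` IS REAL FOR UNITARY `W`** (`(Re W)* = Re W`, `τ(a*) = conj τ(a)`). [cite: Balaban1985BackgroundPropagators, (3.1) p.390] -/
theorem conj_wil {W : 𝔸ˣ} (hW : ((W⁻¹ : 𝔸ˣ) : 𝔸) = star (W : 𝔸)) (τ : 𝔸 →ₗ[ℂ] ℂ) (hτs : ∀ a : 𝔸, τ (star a) = starRingEnd ℂ (τ a)) :
    starRingEnd ℂ (wil τ W) = wil τ W := by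
  unfold wil
  rw [map_sub, ← hτs, ← hτs, star_one, star_reC hW]

omit [CompleteSpace 𝔸] [ContinuousStar 𝔸] in
/-- ★ **THE WILSON FUNCTIONAL IS REAL ON UNITARY CONFIGURATIONS**: `conj 𝒜(V) = 𝒜(V)` for `V(b)⁻¹ = V(b)*` (plaquette variables are unitary, `B9Eq310Hermitian.plaqU_unitary`).
[cite: Balaban1985Variational, (5) p.278; Balaban1985BackgroundPropagators, (3.1) p.390] -/
theorem conj_action {V : ι → S → 𝔸ˣ} (hV : ∀ μ x, (((V μ x)⁻¹ : 𝔸ˣ) : 𝔸) = star (V μ x : 𝔸)) (η : ℝ) (d : ℕ) (τ : 𝔸 →ₗ[ℂ] ℂ)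
    (hτs : ∀ a : 𝔸, τ (star a) = starRingEnd ℂ (τ a)) :
    starRingEnd ℂ (action T η d τ V) = action T η d τ V := by
  unfold action
  rw [map_sum]
  refine Finset.sum_congr rfl fun q _ => ?_
  rw [map_mul, map_pow, Complex.conj_ofReal, conj_wil (plaqU_unitary T V hV _ _ _) τ hτs]

omit [ContinuousStar 𝔸] in
/-- ★★ **`V₀(A)` IS REAL ON THE GROUP**: for a unitary background, a tracial `*`-compatible `τ` and Hermitian `A`, `conj V₀(A) = V₀(A)` — (26) with every summand real: `𝒜(U₁U₀)`,
`𝒜(U₀)` (unitary configurations), `⟨A, J⟩` ([5] (3.11), `J` Hermitian), `½⟨A, ΔA⟩` ([5] (3.10)). [cite: Balaban1985Variational, (26)-(28) p.282; Balaban1985BackgroundPropagators, (3.10)-(3.11) p.392] -/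
theorem conj_V0 [ContinuousStar 𝔸] (hU : ∀ μ x, (((U μ x)⁻¹ : 𝔸ˣ) : 𝔸) = star (U μ x : 𝔸)) (τ : 𝔸 →ₗ[ℂ] ℂ) (hτ : ∀ a b : 𝔸, τ (a * b) = τ (b * a))
    (hτs : ∀ a : 𝔸, τ (star a) = starRingEnd ℂ (τ a)) (η : ℝ) (d : ℕ) {A : ι → S → 𝔸} (hA : ∀ μ x, star (A μ x) = A μ x) :
    starRingEnd ℂ (V0 T U η d τ A) = V0 T U η d τ A := by
  unfold V0
  rw [map_sub, map_sub, map_sub, map_mul, conj_action T (prodCfg_inv_eq_star U hU η hA) η d τ hτs, conj_action T hU η d τ hτs,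
    conj_bondPair τ hτ hτs η d hA (star_J T U hU η), conj_hessPair T U hU τ hτ hτs η d hA, map_inv₀, map_ofNat]

/-- ★★ **`Im V₀(A) = 0` ON THE GROUP** (the `hreal` feed of the `V₀`-summand of (80)). [cite: Balaban1985Variational, (26) p.282, (80) p.289] -/
theorem V0_im_eq_zero (hU : ∀ μ x, (((U μ x)⁻¹ : 𝔸ˣ) : 𝔸) = star (U μ x : 𝔸)) (τ : 𝔸 →ₗ[ℂ] ℂ) (hτ : ∀ a b : 𝔸, τ (a * b) = τ (b * a))
    (hτs : ∀ a : 𝔸, τ (star a) = starRingEnd ℂ (τ a)) (η : ℝ) (d : ℕ) {A : ι → S → 𝔸} (hA : ∀ μ x, star (A μ x) = A μ x) :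
    (V0 T U η d τ A).im = 0 :=
  Complex.conj_eq_iff_im.1 (conj_V0 T U hU τ hτ hτs η d hA)

/-- **`V₀(A)` EQUALS ITS REAL PART** on the group (cast form of `conj_V0`). [cite: Balaban1985Variational, (26) p.282] -/
theorem V0_eq_ofReal_re (hU : ∀ μ x, (((U μ x)⁻¹ : 𝔸ˣ) : 𝔸) = star (U μ x : 𝔸)) (τ : 𝔸 →ₗ[ℂ] ℂ) (hτ : ∀ a b : 𝔸, τ (a * b) = τ (b * a))
    (hτs : ∀ a : 𝔸, τ (star a) = starRingEnd ℂ (τ a)) (η : ℝ) (d : ℕ) {A : ι → S → 𝔸} (hA : ∀ μ x, star (A μ x) = A μ x) :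
    V0 T U η d τ A = (((V0 T U η d τ A).re : ℝ) : ℂ) :=
  (Complex.conj_eq_iff_re.1 (conj_V0 T U hU τ hτ hτs η d hA)).symm

omit [StarRing 𝔸] [ContinuousStar 𝔸] [StarModule ℂ 𝔸] in
/-- **THE `V₀` DICTIONARY, REAL-PART FORM**: `Re V₀(A) = η^{d−4}·Σ_p Re ρ_p(A)` with [5]'s per-plaquette third-order remainder `ρ_p = B9Eq39Adjoint.rem3` — `B11Eq26ActionExpansion.V0_eq_sum_rem3`
((3.12) of [5]) read through `Re` (the S1 side sums `Re ρ_p`; with `V0_eq_ofReal_re` this identifies `V₀` itself on the group). [cite: Balaban1985Variational, (26) p.282; Balaban1985BackgroundPropagators, (3.12) p.392] -/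
theorem re_V0_eq_sum_re_rem3 (τ : 𝔸 →ₗ[ℂ] ℂ) (hτ : ∀ a b : 𝔸, τ (a * b) = τ (b * a)) (η : ℝ) (hη : η ≠ 0) {d : ℕ} (hd : 4 ≤ d) (A : ι → S → 𝔸) :
    (V0 T U η d τ A).re = η ^ (d - 4) * ∑ q ∈ B9Eq39Adjoint.posPlaq S ι, (B9Eq39Adjoint.rem3 T U η τ A q.2.1 q.2.2 q.1).re := by
  rw [B11Eq26ActionExpansion.V0_eq_sum_rem3 T U τ hτ η hη hd A, ← Complex.ofReal_pow, Complex.re_ofReal_mul, Complex.re_sum]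

end Summit.QuantumFields.YangMills.Theorems.K0Stub1V0Reality

end
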